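import Summits.QuantumFields.BalabanUV.Beta.D1BFx.TorusCombKKT
import Summits.QuantumFields.BalabanUV.Beta.D1BFx.PeriodicArrays
import Summits.QuantumFields.BalabanUV.Beta.AxialDressingRootedBmHessian

/-!
# `BalabanUV.Beta.D1BFx.PackedResponseTorus` — road «BF-x» for binder row D1, slot (K), chain step (I) «(A1)-PACKED», brick (B4b)
# «PACKED-DICT-TORUS» (`A1-PACKED-SPEC.md` v0.2 §7): **ON EVERY COARSE TORUS, THE FIELD–MULTIPLIER BLOCK OF A PERIODISED BLOCK-COVARIANT PACKED
# RESOLVENT IS THE PERIODISED `ℋ`-COLUMN**, and **THE RESPONSE TO A COARSE SOURCE IS A COLUMN OF THE TORUS COMB-GAUGED INVERSE** (its source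
# sits in the multiplier rows — the line `packedWard₁` needs).

HONEST DEPENDENCY (cell records, verbatim): «continuum YM on T⁴ ⇐ BetaPertH ∧ nine spine estimates (0/9 proved); BetaPertH ⇐ (D1) ∧ (D4) ∧
CAP+tail; G-an2-4 gates asym, D1 and NE2/3/4.»  HONEST FRAMING (cell contract, verbatim): «discharging `BetaPertH` makes Bałaban's UV stability
UNCONDITIONAL — a real constructive-QFT result; it is NOT the continuum limit and NOT the Clay problem.»  THIS MODULE DISCHARGES NOTHING of (K),
of D1 or of the wall: [folklore] bookkeeping over TA1 (`SortedKernels.blocksHat`, `SortedPack.sortK`, `SortedReblocking.finePt`), the fibrewise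
periodisation `FibredPeriodisation.periodiseF`, `OneStepKernelFamily.colH`, and TB1's `TorusCombKKT.inv_MT_packed_eq` ∕ `isUnit_det_MT` BY NAME.
No definition, no `def … : Prop`, nothing cited, 0 sorry.  0 root-level binders of row D1 discharged; (K) NOT closed; NOT D1, NOT `BetaPertH`,
NOT continuum, NOT Clay.

ABSOLUTE RULE (cell charter, verbatim): «No internally-minted statement may enter as a cited fact. Every hypothesis is either kernel-proved in this
package or a verbatim quotation of a PUBLISHED theorem with page reference. The manuscript(s) under audit are NOT citable for their own disputed
steps — they are the thing under adjudication; programme-internal (2001/route/tribunal) claims are never citable.»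

WHY (owner d1-p2, `A1-PACKED-SPEC.md` v0.2 (B4b); sequel of (B4) `PeriodicArraySuperposition`).  (B4) says: the array of the packed first jet is the
finite window sum `Σ_{bonds ẑ} (Σ'_m colH K n μ y κ′ (ẑ + s·m)) · arr s (S κ′ ẑ)` — periodised `ℋ`-column of the packing resolvent `K` times the per-bond
array.  For «A1-PACKED-TORUS» the periodised `ℋ`-column must be (i) an ENTRY of the torus matrix the (A1) identity works with, and (ii) a RESPONSE in the
sense of `WardJetsFromNoether.packedWard₁`: `𝕄₀ rₛ = e_{inr s}` (source in the multiplier rows, so that the generator tables' `oslot` term dies by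
`oslot_fromRows_zero_eq_zero`).  THIS FILE proves both: §1 the fm entry of `blocksHat p (sortK n K)` IS the periodised `colH K` (block covariance only);
§2 on the torus comb-gauged sharp KKT matrix `M_T = kkt K̂ (fromRows Q̂ τ_T)` the column `rₛ := M_T⁻¹ e_{inr (inl s)}` satisfies `M_T rₛ = e_{inr (inl s)}`
(hence its FIELD rows vanish) and its field entries are the fm entries of `blocksHat p (sortK n G₀)`, `G₀ := coDressKBmAt (toSite r) n (KInvStep n 0)`
(`TorusCombKKT.inv_MT_packed_eq`).  NOT HERE: (B3) itself; the identification of the co-dressed `ℋ`-column with `KInv`'s `wH` (a gauge question — which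
resolvent the (S-LIT) dictionary names is d1-p3's `JcOf`; (B4) serves either via `arr_vertexOfK`).

CONTENT (all [folklore]).
* §1 **`blocksHat_sortK_inl_inr_eq_tsum_colH`**: for `K` with `shiftK (−n•t) K = K`,
  `blocksHat p (sortK n K) (inl (z̄, (ẑ, κ′))) (inr (ȳ, μ)) = Σ'_m colH K n μ (windowMap p ȳ) κ′ (imageShift (n·p) (finePt n (windowMap p z̄) ẑ) m)`.
* §2 `mulVec_inv_col` (a column of the inverse is a response: `M *ᵥ (M⁻¹ · j) = Pi.single j 1` for `IsUnit M.det`); **`MT_mulVec_response`**,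
  **`response_field_rows_eq_zero`** (the field rows of `M_T rₛ` vanish), **`response_inl_eq_blocksHat`** (the field entries of `rₛ` are the fm entries of
  `blocksHat p (sortK n G₀)`), and the composite **`response_inl_eq_tsum_colH`**.
* §3 `tsum_images_eq_of_shift`, **`response_inl_eq_tsum_colH_window`** (the same at the WINDOW representative `windowMap (n·p) (torusBlockEquiv n p (z̄, ẑ))`
  of the fine bond — the form (B4) `arr_vertexOfK` ∕ (B4c) use).
Unit `b2b-balaban-beta-d1-p2` (road owner, gen 16), 2026-08-22.
-/

noncomputable section

namespace Summit.QuantumFields.BalabanUV.Beta.D1BFx.PackedResponseTorus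

open Matrix
open scoped BigOperators
open Literature.Probability.LatticeModels (TorusSite)
open Literature.MathematicalPhysics.QuantumFieldTheory.Balaban1983to89
open Literature.MathematicalPhysics.QuantumFieldTheory.Balaban1983to89.Beta
open Literature.MathematicalPhysics.QuantumFieldTheory.Balaban1983to89.Beta.Composition (kkt)
open ExpKernelCalculus (MKer shiftK)
open AffineAveraging (box toSite)
open OneStepResolventKernel (Fib)
open OneStepKernelFamily (KInvStep colH)
open Summit.QuantumFields.BalabanUV.Beta.AxialDressingRooted (coDressKBmAt shiftK_coDressKBmAt_KInvStep)
open Summit.QuantumFields.BalabanUV.Beta.D1BFx.FibredPeriodisation (periodiseF periodiseF_apply Kfib)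
open Summit.QuantumFields.BalabanUV.Beta.D1BFx.SortedKernels (blocksHat fTR)
open Summit.QuantumFields.BalabanUV.Beta.D1BFx.SortedReblocking (finePt finePt_imageShift imageShift_mul_eq_add torusBlockEquiv torusBlockEquiv_apply exists_windowMap_siteOf)
open Summit.QuantumFields.BalabanUV.Beta.D1BFx.SortedPack (sortK sortK_inl_inr)
open Summit.QuantumFields.BalabanUV.Beta.D1BFx.TorusCombKKT (I J CombRows tauT Khat Qhat isUnit_det_MT inv_MT_packed_eq)

variable {d : ℕ}

/-! ## §1 The fm block of a periodised block-covariant pack is the periodised `ℋ`-column -/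

section FmBlock

variable {n p : ℕ} [NeZero p]

/-- [folklore] fm entries of `blocksHat` are the fibrewise periodisation of the fm fibre block. -/
theorem blocksHat_inl_inr (K : MKer (d + 1) (Fib d)) (i : Beta.Site (d + 1) p × (TorusSite (d + 1) n × Fin (d + 1)))
    (j : Beta.Site (d + 1) p × Fin (d + 1)) :
    blocksHat p (sortK n K) (Sum.inl i) (Sum.inr j) = periodiseF p (fTR (sortK n K)) i j := by
  rw [blocksHat, Matrix.fromBlocks_apply₁₂, Matrix.of_apply]

/-- [folklore] **THE fm ENTRY OF A PERIODISED BLOCK-COVARIANT PACK IS THE PERIODISED `ℋ`-COLUMN.**  For a packed kernel `K` covariant under the block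
translations (`shiftK (−n•t) K = K`), on the coarse torus of period `p`:
`blocksHat p (sortK n K) (inl (z̄, (ẑ, κ′))) (inr (ȳ, μ)) = Σ'_m colH K n μ ŷ κ′ (imageShift (n·p) û m)`, `ŷ := windowMap p ȳ`, `û := finePt n (windowMap p z̄) ẑ`
— the images of the coarse source point are traded for the images of the fine field point by covariance (`m ↦ −m`); no summability is used. -/
theorem blocksHat_sortK_inl_inr_eq_tsum_colH (K : MKer (d + 1) (Fib d)) (hcov : ∀ t : Fin (d + 1) → ℤ, shiftK (-((n : ℤ) • t)) K = K)
    (zbar : Beta.Site (d + 1) p) (zhat : TorusSite (d + 1) n) (κ' : Fin (d + 1)) (ybar : Beta.Site (d + 1) p) (μ : Fin (d + 1)) :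
    blocksHat p (sortK n K) (Sum.inl (zbar, (zhat, κ'))) (Sum.inr (ybar, μ))
      = ∑' m : Fin (d + 1) → ℤ, colH K n μ (windowMap (d + 1) p ybar) κ'
          (imageShift (n * p) (finePt n (windowMap (d + 1) p zbar) zhat) m) := by
  rw [blocksHat_inl_inr, periodiseF_apply]
  unfold periodise₂
  rw [← (Equiv.neg (Fin (d + 1) → ℤ)).tsum_eq]
  refine tsum_congr fun m => ?_
  simp only [Equiv.neg_apply, Kfib, fTR, sortK_inl_inr, colH]
  set û := finePt n (windowMap (d + 1) p zbar) zhat with hû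
  set ŷ := windowMap (d + 1) p ybar with hŷ
  -- covariance under the block translation by `p • (−m)`: trades the coarse image for the fine image
  have h := congrFun (congrFun (congrFun (congrFun (hcov ((p : ℤ) • (-m))) û)
    ((n : ℤ) • ŷ + (n : ℤ) • ((p : ℤ) • (-m)))) (Sum.inl κ')) (Sum.inr μ)
  simp only [shiftK] at h
  have e1 : û + -((n : ℤ) • ((p : ℤ) • (-m))) = imageShift (n * p) û m := by
    funext i; simp only [imageShift, Pi.add_apply, Pi.neg_apply, Pi.smul_apply, smul_eq_mul, Nat.cast_mul]; ring
  have e2 : (n : ℤ) • ŷ + (n : ℤ) • ((p : ℤ) • (-m)) + -((n : ℤ) • ((p : ℤ) • (-m))) = (n : ℤ) • ŷ := by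
    rw [add_neg_cancel_right]
  have e3 : (n : ℤ) • imageShift p ŷ (-m) = (n : ℤ) • ŷ + (n : ℤ) • ((p : ℤ) • (-m)) := by
    funext i; simp only [imageShift, Pi.add_apply, Pi.neg_apply, Pi.smul_apply, smul_eq_mul]; ring
  rw [e1, e2] at h
  rw [e3]
  exact h.symm

end FmBlock

/-! ## §2 The response to a coarse source is a column of the torus comb-gauged inverse -/

section Response

/-- [folklore] **A COLUMN OF THE INVERSE IS A RESPONSE**: `M *ᵥ (M⁻¹ · j) = e_j` for an invertible square matrix. -/
theorem mulVec_inv_col {ι : Type*} [Fintype ι] [DecidableEq ι] (M : Matrix ι ι ℝ) (hM : IsUnit M.det) (j : ι) :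
    M *ᵥ (fun k => M⁻¹ k j) = Pi.single j 1 := by
  funext i
  have h := congrFun (congrFun (Matrix.mul_nonsing_inv M hM) i) j
  rw [Matrix.mul_apply] at h
  rw [Matrix.mulVec, dotProduct, h, Matrix.one_apply, Pi.single_apply]

variable {n : ℕ} [NeZero n] {r : Fin (d + 1) → ℕ} (hr : r ∈ box (d + 1) n) (p : ℕ) [NeZero p]
include hr

/-- [folklore] **THE KKT SOURCE LINE ON THE TORUS**: the response `rₛ := M_T⁻¹ e_{inr (inl s)}` of the comb-gauged sharp KKT matrix
`M_T = kkt K̂ (fromRows Q̂ τ_T)` to the coarse source `s : J d p` satisfies `M_T rₛ = e_{inr (inl s)}` — its source sits in a MULTIPLIER row. -/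
theorem MT_mulVec_response (s : J d p) :
    kkt (Khat (d := d) n p) (Matrix.fromRows (Qhat (d := d) n p) (tauT (toSite r) n p))
        *ᵥ (fun k => (kkt (Khat (d := d) n p) (Matrix.fromRows (Qhat (d := d) n p) (tauT (toSite r) n p)))⁻¹ k (Sum.inr (Sum.inl s)))
      = Pi.single (Sum.inr (Sum.inl s)) 1 :=
  mulVec_inv_col _ (isUnit_det_MT (d := d) hr p) _

/-- [folklore] … hence the FIELD rows of `M_T rₛ` vanish (the hypothesis shape `oslot_fromRows_zero_eq_zero` wants). -/
theorem MT_mulVec_response_inl (s : J d p) (i : I d n p) :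
    (kkt (Khat (d := d) n p) (Matrix.fromRows (Qhat (d := d) n p) (tauT (toSite r) n p))
        *ᵥ (fun k => (kkt (Khat (d := d) n p) (Matrix.fromRows (Qhat (d := d) n p) (tauT (toSite r) n p)))⁻¹ k (Sum.inr (Sum.inl s))))
      (Sum.inl i) = 0 := by
  rw [MT_mulVec_response hr p s, Pi.single_apply, if_neg Sum.inl_ne_inr]

/-- [folklore] **THE FIELD ENTRIES OF THE RESPONSE ARE THE fm ENTRIES OF THE PERIODISED DRESSED PACK** `blocksHat p (sortK n G₀)`,
`G₀ := coDressKBmAt (toSite r) n (KInvStep n 0)` (`TorusCombKKT.inv_MT_packed_eq`: the `(fine ⊕ coarse)` corner of `M_T⁻¹` is `diag(1, −1)·Ĝ₀`; a field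
row picks the `+1`). -/
theorem response_inl_eq_blocksHat (s : J d p) (k : I d n p) :
    (kkt (Khat (d := d) n p) (Matrix.fromRows (Qhat (d := d) n p) (tauT (toSite r) n p)))⁻¹ (Sum.inl k) (Sum.inr (Sum.inl s))
      = blocksHat p (sortK n (coDressKBmAt (toSite r) n (KInvStep (d := d) n 0))) (Sum.inl k) (Sum.inr s) := by
  have h := congrFun (congrFun (inv_MT_packed_eq (d := d) hr p) (Sum.inl k)) (Sum.inr s)
  rw [Matrix.submatrix_apply, Sum.map_inl, Sum.map_inr, id] at h
  rw [h, Matrix.mul_apply, Fintype.sum_sum_type]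
  simp only [Matrix.fromBlocks_apply₁₁, Matrix.fromBlocks_apply₁₂, Matrix.one_apply, Matrix.zero_apply, zero_mul,
    Finset.sum_const_zero, add_zero, ite_mul, one_mul, Finset.sum_ite_eq, Finset.mem_univ, if_true]

/-- [folklore] **(B4b) ASSEMBLED: THE FIELD ENTRIES OF THE TORUS RESPONSE ARE THE PERIODISED `ℋ`-COLUMN OF THE DRESSED ONE-STEP RESOLVENT** —
`rₛ (inl (z̄, (ẑ, κ′))) = Σ'_m colH G₀ n μ ŷ κ′ (imageShift (n·p) û m)` for `s = (ȳ, μ)`, `ŷ = windowMap p ȳ`, `û = finePt n (windowMap p z̄) ẑ` —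
EXACTLY the periodised weight of (B4) `PeriodicArraySuperposition.arr_vertexOfK` at `K := G₀`, `s := n·p` (up to the choice of representative of the
fine bond, which `arr_translate_eq` ∕ a shift of `m` absorbs). -/
theorem response_inl_eq_tsum_colH (ybar : Beta.Site (d + 1) p) (μ : Fin (d + 1)) (zbar : Beta.Site (d + 1) p) (zhat : TorusSite (d + 1) n)
    (κ' : Fin (d + 1)) :
    (kkt (Khat (d := d) n p) (Matrix.fromRows (Qhat (d := d) n p) (tauT (toSite r) n p)))⁻¹ (Sum.inl (zbar, (zhat, κ')))
        (Sum.inr (Sum.inl (ybar, μ)))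
      = ∑' m : Fin (d + 1) → ℤ, colH (coDressKBmAt (toSite r) n (KInvStep (d := d) n 0)) n μ (windowMap (d + 1) p ybar) κ'
          (imageShift (n * p) (finePt n (windowMap (d + 1) p zbar) zhat) m) := by
  rw [response_inl_eq_blocksHat hr p (ybar, μ) (zbar, (zhat, κ'))]
  exact blocksHat_sortK_inl_inr_eq_tsum_colH _ (fun t => shiftK_coDressKBmAt_KInvStep (toSite r) 0 t) zbar zhat κ' ybar μ

end Response

/-! ## §3 The window representative of the fine bond (the form (B4)∕(B4c) use) -/

section Window

variable {n : ℕ} [NeZero n] {r : Fin (d + 1) → ℕ} (hr : r ∈ box (d + 1) n) (p : ℕ) [NeZero p]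
include hr

omit hr in
/-- [folklore] Image sums do not see the choice of representative: `Σ'_m w (û′ + s·m) = Σ'_m w (û + s·m)` if `û′ = û + s·t₀`. -/
theorem tsum_images_eq_of_shift (w : (Fin (d + 1) → ℤ) → ℝ) (s : ℕ) (u t₀ : Fin (d + 1) → ℤ) :
    ∑' m : Fin (d + 1) → ℤ, w (imageShift s (u + (s : ℤ) • t₀) m) = ∑' m : Fin (d + 1) → ℤ, w (imageShift s u m) := by
  rw [← (Equiv.addLeft t₀).tsum_eq (fun m => w (imageShift s u m))]
  refine tsum_congr fun m => ?_
  simp only [Equiv.coe_addLeft]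
  congr 1
  funext i
  simp only [imageShift, Pi.add_apply, Pi.smul_apply, smul_eq_mul]
  ring

/-- [folklore] **THE TORUS RESPONSE AT THE WINDOW REPRESENTATIVE** (the form (B4) `PeriodicArraySuperposition.arr_vertexOfK` ∕ (B4c) use): for `s = (ȳ, μ)`,
`rₛ (inl (z̄, (ẑ, κ′))) = Σ'_m colH G₀ n μ ŷ κ′ (imageShift (n·p) ŵ m)` with `ŵ := windowMap (n·p) (torusBlockEquiv n p (z̄, ẑ))` (§2's `finePt` representative differs from `ŵ` by a
period multiple — `torusBlockEquiv_apply` + `exists_windowMap_siteOf` — and image sums do not see it). -/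
theorem response_inl_eq_tsum_colH_window (ybar : Beta.Site (d + 1) p) (μ : Fin (d + 1)) (zbar : Beta.Site (d + 1) p) (zhat : TorusSite (d + 1) n)
    (κ' : Fin (d + 1)) :
    (kkt (Khat (d := d) n p) (Matrix.fromRows (Qhat (d := d) n p) (tauT (toSite r) n p)))⁻¹ (Sum.inl (zbar, (zhat, κ')))
        (Sum.inr (Sum.inl (ybar, μ)))
      = ∑' m : Fin (d + 1) → ℤ, colH (coDressKBmAt (toSite r) n (KInvStep (d := d) n 0)) n μ (windowMap (d + 1) p ybar) κ'
          (imageShift (n * p) (windowMap (d + 1) (n * p) (torusBlockEquiv n p (zbar, zhat))) m) := by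
  rw [response_inl_eq_tsum_colH hr p ybar μ zbar zhat κ', torusBlockEquiv_apply]
  obtain ⟨t₀, ht⟩ := exists_windowMap_siteOf (p := n * p) (finePt n (windowMap (d + 1) p zbar) zhat)
  rw [ht, Nat.cast_mul]
  rw [show ((n : ℤ) * (p : ℤ)) • t₀ = ((n * p : ℕ) : ℤ) • t₀ by rw [Nat.cast_mul]]
  exact (tsum_images_eq_of_shift _ (n * p) _ t₀).symm

end Window



end Summit.QuantumFields.BalabanUV.Beta.D1BFx.PackedResponseTorus

end
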